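import Summits.CriticalPhenomena.PercolationContinuityZ3.Theorems.Transplant.FKConnectivityAllQPartitionAssoc
import Summits.CriticalPhenomena.PercolationContinuityZ3.Theorems.PercNearOneGluingNoHeavyLowerTailFKExactEval
import HarnessLib

/-!
# Connectivity correlation inequalities for `φ_{w,q}`, every `q > 0` — the cluster PARTITION is NOT positively associated for
# `q < 1`: refutation of the node `PartitionAssocFKPos` by an exact computation on the four-cycle

Support file (`--supports stmt-CriticalPhenomena-4575`), FK sub-lane `prim-bschramm-fk-1` (gen 7) of the post-continuity
programme; builds on p205010 (kernel theorem, internal audit signed; external expert review pending).  One `abbrev` (the listed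
weighted four-cycle), no named facts, no sorries; standard axioms (`decide`, no `native_decide`).

WITNESS (found by the exhaustive part of kit j-census fk1g7-pa, all 347 up-sets of the partition lattice of a 4-set): the four-cycle
`0 – 2 – 1 – 3 – 0` (pairs `02, 03, 12, 13`), all parameters `½`, `q = ½`.  The coarsening-closed events `U = {1 ↔ 2 or 1 ↔ 3}`
("the cluster of `1` is non-trivial") and `V = {0 ↔ 2 or 0 ↔ 3}` have `φ(U) = φ(V) = 64/73` and `φ(U ∩ V) = 56/73 < (64/73)²`
(`Z = 73/256`; covariance `−8/5329`; the covariance is `< 0` for every tested `q < 1`, `= 0` at `q = 1`, `> 0` at `q = 2`).  So for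
`q < 1` the clusters of DIFFERENT vertices compete — positive association of the whole partition (`PartitionAssocFKPos`, true for
`q ≥ 1` by FKG) FAILS — while association of the cluster of ONE vertex (`ClusterAssocFKPos`) and pairwise positive correlation of
connection events (`PairConnPosFKPos`) survive every census of this lane.  [cite: Grimmett2006, §1.4 eq. (1.20) (p. 15); §3.9 (p. 63)]
[cite: AyyerLinussonRavichandran2025, §7 eq. (13)–(15) (p. 22)]
-/

noncomputable section

namespace Summit.CriticalPhenomena.PercolationContinuityZ3.Theorems

namespace FK

open MeasureTheory Set Literature.Probability.LatticeModels Literature.Probability.Percolation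
open scoped Classical

namespace PartitionAssocCex

/-- The listed weighted four-cycle `0–2–1–3–0` on `Fin 4`: pairs `02, 03, 12, 13`, all parameters `½`, `q = ½` (reducible, so that
`Fin cyc.n` is `Fin 4`). [cite: Grimmett2006, §1.4 eq. (1.20) (p. 15)] -/
abbrev cyc : RCEval := ⟨4, 4, ![0, 0, 1, 1], ![2, 3, 2, 3], fun _ => 1 / 2, 1 / 2⟩

/-- The data are valid (distinct pairs, parameters in `[0,1]`, `q > 0`). [folklore] -/
theorem cyc_valid : cyc.Valid := by decide +kernel

/-- Computable predicate of `U = {1 ↔ 2 or 1 ↔ 3}`. [folklore] -/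
def pU (t : Finset (Fin 4)) : Bool := cyc.reachB t 1 2 || cyc.reachB t 1 3

/-- Computable predicate of `V = {0 ↔ 2 or 0 ↔ 3}`. [folklore] -/
def pV (t : Finset (Fin 4)) : Bool := cyc.reachB t 0 2 || cyc.reachB t 0 3

/-- The partition function: `Z = 73/256`. [cite: Grimmett2006, §1.4 eq. (1.20) (p. 15)] -/
theorem zq_val : cyc.ZQ = 73 / 256 := by decide +kernel

/-- Mass of `U`: `1/4` (so `φ(U) = 64/73`). [cite: Grimmett2006, §1.4 eq. (1.20) (p. 15)] -/
theorem massU_val : cyc.massQ pU = 1 / 4 := by decide +kernel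

/-- Mass of `V`: `1/4`. [cite: Grimmett2006, §1.4 eq. (1.20) (p. 15)] -/
theorem massV_val : cyc.massQ pV = 1 / 4 := by decide +kernel

/-- Mass of `U ∩ V`: `7/32` (so `φ(U ∩ V) = 56/73`). [cite: Grimmett2006, §1.4 eq. (1.20) (p. 15)] -/
theorem massUV_val : cyc.massQ (fun t => pU t && pV t) = 7 / 32 := by decide +kernel

/-- The family "contains the pair `a b` or the pair `a c`" is an up-set of pair-sets. [folklore] -/
theorem isUpperSet_or (a b c : Fin 4) : IsUpperSet {P : Set (Sym2 (Fin 4)) | s(a, b) ∈ P ∨ s(a, c) ∈ P} := by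
  intro P Q hPQ hP
  rcases hP with h | h
  · exact Or.inl (hPQ h)
  · exact Or.inr (hPQ h)

/-- `conf t ∈ {π : ab ∈ π or ac ∈ π}` iff `reachB t a b || reachB t a c`. [folklore] -/
theorem conf_mem_partIn_or_iff (a b c : Fin 4) (t : Finset (Fin 4)) :
    cyc.conf t ∈ partIn {P : Set (Sym2 (Fin 4)) | s(a, b) ∈ P ∨ s(a, c) ∈ P} ↔
      (cyc.reachB t a b || cyc.reachB t a c) = true := by
  rw [Bool.or_eq_true, RCEval.reachB_iff, RCEval.reachB_iff]
  show (s(a, b) ∈ connSet (cyc.conf t) ∨ s(a, c) ∈ connSet (cyc.conf t)) ↔ _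
  rw [mk_mem_connSet_iff, mk_mem_connSet_iff]

end PartitionAssocCex

open PartitionAssocCex

/-- **The cluster partition of `φ_{w,q}` is NOT positively associated for `q < 1`: `¬ PartitionAssocFKPos`.**  Witness: the
four-cycle `0–2–1–3–0`, parameters `½`, `q = ½`, `U = {1 ↔ 2 or 1 ↔ 3}`, `V = {0 ↔ 2 or 0 ↔ 3}`: `φ(U)φ(V) = (64/73)² > 56/73 = φ(U ∩ V)`.
(refuted-substantive: the competing events concern the clusters of two DIFFERENT vertices; the one-vertex statement
`ClusterAssocFKPos` is not touched.) [cite: Grimmett2006, §1.4 eq. (1.20) (p. 15); §3.9 (p. 63)]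
[cite: AyyerLinussonRavichandran2025, §7 eq. (13)–(15) (p. 22)] -/
theorem not_partitionAssocFKPos : ¬ PartitionAssocFKPos := by
  intro h
  have hq : (0 : ℝ) < ((1 / 2 : ℚ) : ℝ) := by norm_num
  have key := h ((1 / 2 : ℚ) : ℝ) hq 4 cyc.w {P | s(1, 2) ∈ P ∨ s(1, 3) ∈ P} {P | s(0, 2) ∈ P ∨ s(0, 3) ∈ P}
    (isUpperSet_or 1 2 3) (isUpperSet_or 0 2 3)
  have hqq : ((1 / 2 : ℚ) : ℝ) = ((cyc.q : ℚ) : ℝ) := rfl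
  rw [hqq] at key
  rw [RCEval.real_eq_massQ_div cyc_valid (P := pU) (fun t => conf_mem_partIn_or_iff 1 2 3 t),
    RCEval.real_eq_massQ_div cyc_valid (P := pV) (fun t => conf_mem_partIn_or_iff 0 2 3 t),
    RCEval.real_eq_massQ_div cyc_valid (P := fun t => pU t && pV t) (fun t => by
      rw [Set.mem_inter_iff, conf_mem_partIn_or_iff 1 2 3 t, conf_mem_partIn_or_iff 0 2 3 t, Bool.and_eq_true]; rfl),
    massU_val, massV_val, massUV_val, zq_val] at key
  norm_num at key

end FK

end Summit.CriticalPhenomena.PercolationContinuityZ3.Theorems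

end
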